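import Literature.MathematicalPhysics.QuantumFieldTheory.ConformalBootstrap3D.BlockZSeries
import Literature.MathematicalPhysics.QuantumFieldTheory.ConformalBootstrap3D.BoundaryCellPositivity

/-!
# The Legendre growth comparison and the tail rule for point functionals

Architecture B″ (real off-diagonal point functionals `φ = Σ_k w_k ev_{(z_k, z̄_k)}`) decides the
positivity of `φ[F^{s}_{-}[g_{Δ,ℓ}]]` termwise on the `z`-series
`g_{Δ,ℓ}(x,y) = Σ_{(n,j)} (A_{n,j}/λ_ℓ) 𝒫_{Δ+n,j}(x,y)` (`IsConformalBlock3D.hasSum_hrZTerm`,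
`blockPositive_pointFunctional_of_forall`), where `𝒫_{E,j}(x,y) = zMono E j x y = s^E P_j(ξ)` with
`s = √(xy)`, `ξ = (x+y)/(2√(xy)) = cosh(log ρ)`, `ρ = √(x/y)` (Hogervorst–Rychkov 2013, §3 eq. (3.6)).
[cite: HogervorstRychkov2013, §3 eq. (3.6)]

This file proves the one analytic input beyond the diagonal case that the TAIL of such a
certificate needs — the **Legendre growth comparison**: for two points `(x,y)`, `(x',y')` of the
square with `0 < y ≤ x`, `0 < y' ≤ x'` and a ratio `q > 0` with `xy ≤ q² x'y'` (`s ≤ q s'`) and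
`x ≤ q x'` (`s ρ ≤ q s' ρ'`),
`𝒫_{E,j}(x,y) ≤ q^E 𝒫_{E,j}(x',y')` for every `j ≤ E` (`zMono_le_of_dominated`). In the variables
`(s, ρ)` this is the elementary estimate `P_j(ξ) ≤ max(1, ρ/ρ')^j P_j(ξ')` (from
`P_j(cosh t) = Σ_m λ_m λ_{j-m} cosh((j-2m)t)` with non-negative coefficients), combined with
`s^E ≤ (s/s')^E s'^E`; here it is proved directly on the polynomial `zLegendre` by pairing the
monomials `x^a y^b + x^b y^a` (`pairTerm_le`, `two_mul_zLegendre`). [folklore]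

Consequence (`tail_blockPositive_pointFunctional_of_apex`): if one node `a` (the apex) dominates
every direct node `(z_k, z̄_k)` with ratio `qd_k ≤ 1` and every reflected node `(1-z_k, 1-z̄_k)` with
ratio `qr_k ≤ 1` in the above sense, then for every `(n, j)` on the descendant range and
`E = Δ + n ≥ Δ⋆`,
`φ[F^{s}_{-}[𝒫_{E,j}]] ≥ 𝒫_{E,j}(z_a, z̄_a) · (w_a v_a^s - Σ_{k ≠ a} |w_k| v_k^s qd_k^{Δ⋆} - Σ_k |w_k| u_k^s qr_k^{Δ⋆})`
(`v = (1-z)(1-z̄)`, `u = z z̄`), so ONE inequality `B(s) ≥ 0` gives `BlockPositive φ s Δ ℓ` for every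
regular `Δ ≥ Δ⋆` and every spin; non-regular points follow by the limit clause
(`blockPositive_of_eventually_right` and `eventually_isRegularPoint3D_nhdsGT_of_bound_le`: above the
unitarity bound the accidental-degeneracy set of a spin is finite), and a box `s ∈ [s_lo, s_hi]` is
handled by monotonicity of `v^s`, `u^s` in `s` (`tail_nonneg_pointFunctional_of_apex`, the shape of
obligation (O5) of `SingleCorrelatorObligations`). [folklore]

No block is evaluated here; these are inequalities between the terms of the proved expansion.
-/

noncomputable section

namespace Literature.MathematicalPhysics.QuantumFieldTheory.ConformalBootstrap3D

open Finset Set Filter Topology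

/-! ### The paired-monomial comparison -/

/-- **Paired-monomial growth comparison.** For `0 < y ≤ x`, `0 < y' ≤ x'`, `0 ≤ q`,
`xy ≤ q² x'y'` and `x ≤ q x'`:
`x^{b+m} y^{b} + x^{b} y^{b+m} ≤ q^{2b+m} (x'^{b+m} y'^{b} + x'^{b} y'^{b+m})`.
(With `s = √(xy)`, `ρ = √(x/y)`, `j = 2b+m` this reads `s^j (ρ^m + ρ^{-m}) ≤ q^j s'^j (ρ'^m + ρ'^{-m})`;
case `ρ ≥ ρ'`: `x^m + y^m ≤ (x/x')^m (x'^m + y'^m)`; case `ρ ≤ ρ'`: compare squares using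
`PQ(P'+Q')² - (P+Q)²P'Q' = (QP' - PQ')(PP' - QQ')`.) [folklore] -/
theorem pairTerm_le {x y x' y' q : ℝ} (hy : 0 < y) (hyx : y ≤ x) (hy' : 0 < y') (hyx' : y' ≤ x')
    (hq : 0 ≤ q) (hs : x * y ≤ q ^ 2 * (x' * y')) (hxx : x ≤ q * x') (b m : ℕ) :
    x ^ (b + m) * y ^ b + x ^ b * y ^ (b + m) ≤
      q ^ (2 * b + m) * (x' ^ (b + m) * y' ^ b + x' ^ b * y' ^ (b + m)) := by
  have hx : 0 < x := hy.trans_le hyx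
  have hx' : 0 < x' := hy'.trans_le hyx'
  have hP : 0 < x ^ m := pow_pos hx m
  have hQ : 0 < y ^ m := pow_pos hy m
  have hP' : 0 < x' ^ m := pow_pos hx' m
  have hQ' : 0 < y' ^ m := pow_pos hy' m
  have hQP : y ^ m ≤ x ^ m := pow_le_pow_left₀ hy.le hyx m
  have hQP' : y' ^ m ≤ x' ^ m := pow_le_pow_left₀ hy'.le hyx' m
  have hxy : 0 < x * y := mul_pos hx hy
  have hxy' : 0 < x' * y' := mul_pos hx' hy'
  have hL : x ^ (b + m) * y ^ b + x ^ b * y ^ (b + m) = (x * y) ^ b * (x ^ m + y ^ m) := by ring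
  have hR : x' ^ (b + m) * y' ^ b + x' ^ b * y' ^ (b + m) = (x' * y') ^ b * (x' ^ m + y' ^ m) := by
    ring
  rw [hL, hR]
  have hsb : (x * y) ^ b ≤ q ^ (2 * b) * (x' * y') ^ b := by
    calc (x * y) ^ b ≤ (q ^ 2 * (x' * y')) ^ b := pow_le_pow_left₀ hxy.le hs b
      _ = q ^ (2 * b) * (x' * y') ^ b := by rw [mul_pow, pow_mul]
  rcases le_total (y ^ m * x' ^ m) (x ^ m * y' ^ m) with hB | hA
  · -- case ρ' ≤ ρ (`Q P' ≤ P Q'`): x^m + y^m ≤ (x^m/x'^m)(x'^m + y'^m) ≤ q^m (x'^m + y'^m)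
    have hPm : x ^ m ≤ q ^ m * x' ^ m := by
      calc x ^ m ≤ (q * x') ^ m := pow_le_pow_left₀ hx.le hxx m
        _ = q ^ m * x' ^ m := mul_pow q x' m
    have h1 : (x ^ m + y ^ m) * x' ^ m ≤ x ^ m * (x' ^ m + y' ^ m) := by nlinarith [hB]
    have h2 : x ^ m + y ^ m ≤ q ^ m * (x' ^ m + y' ^ m) := by
      have h3 : (x ^ m + y ^ m) * x' ^ m ≤ q ^ m * (x' ^ m + y' ^ m) * x' ^ m := by
        calc (x ^ m + y ^ m) * x' ^ m ≤ x ^ m * (x' ^ m + y' ^ m) := h1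
          _ ≤ q ^ m * x' ^ m * (x' ^ m + y' ^ m) :=
              mul_le_mul_of_nonneg_right hPm (by positivity)
          _ = q ^ m * (x' ^ m + y' ^ m) * x' ^ m := by ring
      exact le_of_mul_le_mul_right h3 hP'
    calc (x * y) ^ b * (x ^ m + y ^ m)
        ≤ q ^ (2 * b) * (x' * y') ^ b * (q ^ m * (x' ^ m + y' ^ m)) :=
          mul_le_mul hsb h2 (by positivity) (by positivity)
      _ = q ^ (2 * b + m) * ((x' * y') ^ b * (x' ^ m + y' ^ m)) := by rw [pow_add]; ring
  · -- case ρ ≤ ρ' (`P Q' ≤ Q P'`): compare squares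
    have hkey : (x ^ m + y ^ m) ^ 2 * (x' ^ m * y' ^ m) ≤
        x ^ m * y ^ m * (x' ^ m + y' ^ m) ^ 2 := by
      nlinarith [mul_nonneg (sub_nonneg.2 hA) (sub_nonneg.2 (mul_le_mul hQP hQP' hQ'.le hP.le))]
    have hL0 : 0 ≤ (x * y) ^ b * (x ^ m + y ^ m) := by positivity
    have hR0 : 0 ≤ q ^ (2 * b + m) * ((x' * y') ^ b * (x' ^ m + y' ^ m)) := by positivity
    rw [← pow_le_pow_iff_left₀ hL0 hR0 two_ne_zero]
    have hm0 : 0 < (x' * y') ^ m := pow_pos hxy' m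
    refine le_of_mul_le_mul_right ?_ hm0
    have hsj : (x * y) ^ (2 * b + m) ≤ q ^ (2 * (2 * b + m)) * (x' * y') ^ (2 * b + m) := by
      calc (x * y) ^ (2 * b + m) ≤ (q ^ 2 * (x' * y')) ^ (2 * b + m) :=
            pow_le_pow_left₀ hxy.le hs _
        _ = q ^ (2 * (2 * b + m)) * (x' * y') ^ (2 * b + m) := by rw [mul_pow, pow_mul]
    calc ((x * y) ^ b * (x ^ m + y ^ m)) ^ 2 * (x' * y') ^ m
        = (x * y) ^ (2 * b) * ((x ^ m + y ^ m) ^ 2 * (x' ^ m * y' ^ m)) := by ring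
      _ ≤ (x * y) ^ (2 * b) * (x ^ m * y ^ m * (x' ^ m + y' ^ m) ^ 2) :=
          mul_le_mul_of_nonneg_left hkey (by positivity)
      _ = (x * y) ^ (2 * b + m) * (x' ^ m + y' ^ m) ^ 2 := by ring
      _ ≤ q ^ (2 * (2 * b + m)) * (x' * y') ^ (2 * b + m) * (x' ^ m + y' ^ m) ^ 2 :=
          mul_le_mul_of_nonneg_right hsj (by positivity)
      _ = (q ^ (2 * b + m) * ((x' * y') ^ b * (x' ^ m + y' ^ m))) ^ 2 * (x' * y') ^ m := by ring

/-! ### The growth comparison for `𝒫_j` and `𝒫_{E,j}` -/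

/-- Pairing of the monomials of `𝒫_j`: `2 𝒫_j(x,y) = Σ_{i+r=j} λ_i λ_r (x^i y^r + x^r y^i)`. [folklore] -/
theorem two_mul_zLegendre (j : ℕ) (x y : ℝ) :
    2 * zLegendre j x y = ∑ c ∈ antidiagonal j,
      legendreLam c.1 * legendreLam c.2 * (x ^ c.1 * y ^ c.2 + x ^ c.2 * y ^ c.1) := by
  have h : zLegendre j x y = zLegendre j y x := zLegendre_symm j y x
  rw [two_mul]
  nth_rewrite 2 [h]
  unfold zLegendre
  rw [← sum_add_distrib]
  exact sum_congr rfl fun c _ => by ring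

/-- **Legendre growth comparison** (`E = j`): under the domination hypotheses of `pairTerm_le`,
`𝒫_j(x,y) ≤ q^j 𝒫_j(x',y')`, i.e. `s^j P_j(ξ) ≤ q^j s'^j P_j(ξ')` whenever `s ≤ q s'` and
`s ρ ≤ q s' ρ'`. [folklore] -/
theorem zLegendre_le_of_dominated {x y x' y' q : ℝ} (hy : 0 < y) (hyx : y ≤ x) (hy' : 0 < y')
    (hyx' : y' ≤ x') (hq : 0 ≤ q) (hs : x * y ≤ q ^ 2 * (x' * y')) (hxx : x ≤ q * x') (j : ℕ) :
    zLegendre j x y ≤ q ^ j * zLegendre j x' y' := by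
  have key : ∀ c ∈ antidiagonal j, x ^ c.1 * y ^ c.2 + x ^ c.2 * y ^ c.1 ≤
      q ^ j * (x' ^ c.1 * y' ^ c.2 + x' ^ c.2 * y' ^ c.1) := by
    intro c hc
    rw [mem_antidiagonal] at hc
    rcases le_total c.2 c.1 with h | h
    · obtain ⟨m, hm⟩ := Nat.exists_eq_add_of_le h
      have hj : j = 2 * c.2 + m := by omega
      rw [hm, hj]
      exact pairTerm_le hy hyx hy' hyx' hq hs hxx c.2 m
    · obtain ⟨m, hm⟩ := Nat.exists_eq_add_of_le h
      have hj : j = 2 * c.1 + m := by omega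
      rw [hm, hj, add_comm (x ^ c.1 * y ^ (c.1 + m)), add_comm (x' ^ c.1 * y' ^ (c.1 + m))]
      exact pairTerm_le hy hyx hy' hyx' hq hs hxx c.1 m
  have h2 : 2 * zLegendre j x y ≤ q ^ j * (2 * zLegendre j x' y') := by
    rw [two_mul_zLegendre, two_mul_zLegendre, mul_sum]
    refine sum_le_sum fun c hc => ?_
    have hlam : 0 ≤ legendreLam c.1 * legendreLam c.2 :=
      mul_nonneg (legendreLam_pos _).le (legendreLam_pos _).le
    calc legendreLam c.1 * legendreLam c.2 * (x ^ c.1 * y ^ c.2 + x ^ c.2 * y ^ c.1)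
        ≤ legendreLam c.1 * legendreLam c.2 *
            (q ^ j * (x' ^ c.1 * y' ^ c.2 + x' ^ c.2 * y' ^ c.1)) :=
          mul_le_mul_of_nonneg_left (key c hc) hlam
      _ = q ^ j * (legendreLam c.1 * legendreLam c.2 *
            (x' ^ c.1 * y' ^ c.2 + x' ^ c.2 * y' ^ c.1)) := by ring
  linarith

/-- **Legendre growth comparison for `𝒫_{E,j}`, `j ≤ E`.** Under the domination hypotheses
(`0 < y ≤ x`, `0 < y' ≤ x'`, `0 < q`, `xy ≤ q² x'y'`, `x ≤ q x'`):
`𝒫_{E,j}(x,y) ≤ q^E 𝒫_{E,j}(x',y')`. This is the inequality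
`s^E P_j(ξ) ≤ q^E s'^E P_j(ξ')`, `q = (s/s') max(1, ρ/ρ')`, used by the tail rule of a point-functional
certificate. [folklore] -/
theorem zMono_le_of_dominated {x y x' y' q : ℝ} (hy : 0 < y) (hyx : y ≤ x) (hy' : 0 < y')
    (hyx' : y' ≤ x') (hq : 0 < q) (hs : x * y ≤ q ^ 2 * (x' * y')) (hxx : x ≤ q * x')
    {E : ℝ} {j : ℕ} (hjE : (j : ℝ) ≤ E) :
    zMono E j x y ≤ q ^ E * zMono E j x' y' := by
  have hx : 0 < x := hy.trans_le hyx
  have hx' : 0 < x' := hy'.trans_le hyx'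
  have ht : 0 ≤ (E - (j : ℝ)) / 2 := by linarith
  unfold zMono
  have h1 : (x * y) ^ ((E - (j : ℝ)) / 2) ≤
      q ^ (E - (j : ℝ)) * (x' * y') ^ ((E - (j : ℝ)) / 2) := by
    calc (x * y) ^ ((E - (j : ℝ)) / 2) ≤ (q ^ 2 * (x' * y')) ^ ((E - (j : ℝ)) / 2) :=
          Real.rpow_le_rpow (mul_pos hx hy).le hs ht
      _ = (q ^ 2) ^ ((E - (j : ℝ)) / 2) * (x' * y') ^ ((E - (j : ℝ)) / 2) :=
          Real.mul_rpow (sq_nonneg q) (mul_pos hx' hy').le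
      _ = q ^ (E - (j : ℝ)) * (x' * y') ^ ((E - (j : ℝ)) / 2) := by
          congr 1
          rw [← Real.rpow_natCast q 2, ← Real.rpow_mul hq.le]
          congr 1
          push_cast
          ring
  have h2 := zLegendre_le_of_dominated hy hyx hy' hyx' hq.le hs hxx j
  calc (x * y) ^ ((E - (j : ℝ)) / 2) * zLegendre j x y
      ≤ (q ^ (E - (j : ℝ)) * (x' * y') ^ ((E - (j : ℝ)) / 2)) * (q ^ j * zLegendre j x' y') :=
        mul_le_mul h1 h2 (zLegendre_nonneg j hx.le hy.le) (by positivity)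
    _ = (q ^ (E - (j : ℝ)) * q ^ (j : ℝ)) *
          ((x' * y') ^ ((E - (j : ℝ)) / 2) * zLegendre j x' y') := by
        rw [Real.rpow_natCast]; ring
    _ = q ^ E * ((x' * y') ^ ((E - (j : ℝ)) / 2) * zLegendre j x' y') := by
        rw [← Real.rpow_add hq, sub_add_cancel]

/-! ### Regular points are open-dense to the right above the unitarity bound -/

/-- Above the unitarity bound the accidental-degeneracy set of a spin `ℓ` is finite (its witnesses
have `n, j < ℓ`, `accidentalDegeneracy3D_unreachable`), so the points just to the right of ANY
`Δ₀ ≥ unitarityBound3D ℓ` are regular. [folklore] -/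
theorem eventually_isRegularPoint3D_nhdsGT_of_bound_le {Δ₀ : ℝ} {ℓ : ℕ}
    (h : unitarityBound3D ℓ ≤ Δ₀) : ∀ᶠ Δ in 𝓝[>] Δ₀, IsRegularPoint3D Δ ℓ := by
  let root : ℕ × ℕ → ℝ := fun p =>
    ((ℓ : ℝ) * ((ℓ : ℝ) + 1) - (p.2 : ℝ) * ((p.2 : ℝ) + 1) - (p.1 : ℝ) * ((p.1 : ℝ) - 3)) /
      (2 * (p.1 : ℝ))
  let T : Finset ℝ := ((Finset.range ℓ) ×ˢ (Finset.range ℓ)).image root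
  have hT : ∀ᶠ Δ in 𝓝[>] Δ₀, ∀ t ∈ T, Δ ≠ t := by
    simp only [eventually_all_finset]
    intro t _
    by_cases ht : Δ₀ < t
    · filter_upwards [Ioo_mem_nhdsGT ht] with Δ hΔ using ne_of_lt hΔ.2
    · filter_upwards [self_mem_nhdsWithin] with Δ hΔ
      exact ne_of_gt (lt_of_le_of_lt (not_lt.1 ht) (Set.mem_Ioi.1 hΔ))
  filter_upwards [hT, self_mem_nhdsWithin] with Δ hΔT hΔ
  have hΔ' : unitarityBound3D ℓ < Δ := lt_of_le_of_lt h (Set.mem_Ioi.1 hΔ)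
  refine ⟨ne_of_gt hΔ', fun hdeg => ?_⟩
  obtain ⟨n, j, hn, hjn, -, hpiv⟩ := accidentalDegeneracy3D_unreachable hΔ' hdeg
  have hmem : root (n, j) ∈ T :=
    Finset.mem_image.2 ⟨(n, j), Finset.mem_product.2
      ⟨Finset.mem_range.2 (by omega), Finset.mem_range.2 (by omega)⟩, rfl⟩
  refine hΔT (root (n, j)) hmem ?_
  unfold casimirPivot3D at hpiv
  have hn1 : (1 : ℝ) ≤ (n : ℝ) := by exact_mod_cast hn
  have hn0 : (2 * (n : ℝ)) ≠ 0 := by positivity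
  show Δ = ((ℓ : ℝ) * ((ℓ : ℝ) + 1) - (j : ℝ) * ((j : ℝ) + 1) - (n : ℝ) * ((n : ℝ) - 3)) /
      (2 * (n : ℝ))
  rw [eq_div_iff hn0]
  linarith

/-! ### The tail rule for a point functional with a dominating apex -/

/-- **Termwise lower bound at a dominated configuration.** Nodes `(z_k, z̄_k)` in the open square
with `z̄_k ≤ z_k`; an apex node `a`; ratios `qd_k, qr_k > 0` with
`z_k z̄_k ≤ qd_k² z_a z̄_a`, `z_k ≤ qd_k z_a` (direct nodes) and
`(1-z_k)(1-z̄_k) ≤ qr_k² z_a z̄_a`, `1-z̄_k ≤ qr_k z_a` (reflected nodes). Then for `j ≤ E`,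
`φ[F^{s}_{-}[𝒫_{E,j}]] ≥ 𝒫_{E,j}(z_a,z̄_a) · (w_a v_a^s - Σ_{k≠a} |w_k| v_k^s qd_k^E - Σ_k |w_k| u_k^s qr_k^E)`
with `v_k = (1-z_k)(1-z̄_k)`, `u_k = z_k z̄_k`. [folklore] -/
theorem pointFunctional_crossF_zMono_lower {N : ℕ} (w z zb : Fin N → ℝ)
    (hz : ∀ k, z k ∈ Ioo (0 : ℝ) 1) (hzb : ∀ k, zb k ∈ Ioo (0 : ℝ) 1) (hord : ∀ k, zb k ≤ z k)
    (a : Fin N) (qd qr : Fin N → ℝ) (hqd : ∀ k, 0 < qd k) (hqr : ∀ k, 0 < qr k)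
    (hdomd : ∀ k, z k * zb k ≤ qd k ^ 2 * (z a * zb a) ∧ z k ≤ qd k * z a)
    (hdomr : ∀ k, (1 - z k) * (1 - zb k) ≤ qr k ^ 2 * (z a * zb a) ∧ 1 - zb k ≤ qr k * z a)
    {E : ℝ} {j : ℕ} (hjE : (j : ℝ) ≤ E) (s : ℝ) :
    zMono E j (z a) (zb a) *
        (w a * ((1 - z a) * (1 - zb a)) ^ s
          - ∑ k ∈ univ.erase a, |w k| * ((1 - z k) * (1 - zb k)) ^ s * qd k ^ E
          - ∑ k, |w k| * (z k * zb k) ^ s * qr k ^ E) ≤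
      pointFunctional w z zb (crossF s (-1) (zMono E j)) := by
  have hv0 : ∀ k, 0 ≤ (1 - z k) * (1 - zb k) := fun k =>
    mul_nonneg (by linarith [(hz k).2]) (by linarith [(hzb k).2])
  have hu0 : ∀ k, 0 ≤ z k * zb k := fun k => mul_nonneg (hz k).1.le (hzb k).1.le
  have hM0 : 0 ≤ zMono E j (z a) (zb a) := zMono_nonneg E j (hz a).1.le (hzb a).1.le
  -- direct nodes are dominated by the apex
  have hMk : ∀ k, zMono E j (z k) (zb k) ≤ qd k ^ E * zMono E j (z a) (zb a) := fun k =>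
    zMono_le_of_dominated (hzb k).1 (hord k) (hzb a).1 (hord a) (hqd k) (hdomd k).1 (hdomd k).2 hjE
  -- reflected nodes are dominated by the apex
  have hRk : ∀ k, zMono E j (1 - z k) (1 - zb k) ≤ qr k ^ E * zMono E j (z a) (zb a) := by
    intro k
    rw [← zMono_symm]
    have h1 : (1 - zb k) * (1 - z k) ≤ qr k ^ 2 * (z a * zb a) := by
      rw [mul_comm]; exact (hdomr k).1
    exact zMono_le_of_dominated (by linarith [(hz k).2]) (by linarith [hord k]) (hzb a).1 (hord a)
      (hqr k) h1 (hdomr k).2 hjE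
  -- termwise lower bounds
  have hterm1 : ∀ k, -(|w k| * ((1 - z k) * (1 - zb k)) ^ s * qd k ^ E * zMono E j (z a) (zb a)) ≤
      w k * ((1 - z k) * (1 - zb k)) ^ s * zMono E j (z k) (zb k) := by
    intro k
    have hvs : 0 ≤ ((1 - z k) * (1 - zb k)) ^ s := Real.rpow_nonneg (hv0 k) s
    have h1 : -|w k| * (((1 - z k) * (1 - zb k)) ^ s * zMono E j (z k) (zb k)) ≤
        w k * (((1 - z k) * (1 - zb k)) ^ s * zMono E j (z k) (zb k)) :=
      mul_le_mul_of_nonneg_right (neg_abs_le _)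
        (mul_nonneg hvs (zMono_nonneg E j (hz k).1.le (hzb k).1.le))
    have h2 : -|w k| * ((1 - z k) * (1 - zb k)) ^ s * (qd k ^ E * zMono E j (z a) (zb a)) ≤
        -|w k| * ((1 - z k) * (1 - zb k)) ^ s * zMono E j (z k) (zb k) :=
      mul_le_mul_of_nonpos_left (hMk k)
        (mul_nonpos_of_nonpos_of_nonneg (neg_nonpos.2 (abs_nonneg _)) hvs)
    calc -(|w k| * ((1 - z k) * (1 - zb k)) ^ s * qd k ^ E * zMono E j (z a) (zb a))
        = -|w k| * ((1 - z k) * (1 - zb k)) ^ s * (qd k ^ E * zMono E j (z a) (zb a)) := by ring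
      _ ≤ -|w k| * ((1 - z k) * (1 - zb k)) ^ s * zMono E j (z k) (zb k) := h2
      _ = -|w k| * (((1 - z k) * (1 - zb k)) ^ s * zMono E j (z k) (zb k)) := by ring
      _ ≤ w k * (((1 - z k) * (1 - zb k)) ^ s * zMono E j (z k) (zb k)) := h1
      _ = w k * ((1 - z k) * (1 - zb k)) ^ s * zMono E j (z k) (zb k) := by ring
  have hterm2 : ∀ k, -(|w k| * (z k * zb k) ^ s * qr k ^ E * zMono E j (z a) (zb a)) ≤
      -(w k * (z k * zb k) ^ s * zMono E j (1 - z k) (1 - zb k)) := by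
    intro k
    have hus : 0 ≤ (z k * zb k) ^ s := Real.rpow_nonneg (hu0 k) s
    apply neg_le_neg
    have h1 : w k * ((z k * zb k) ^ s * zMono E j (1 - z k) (1 - zb k)) ≤
        |w k| * ((z k * zb k) ^ s * zMono E j (1 - z k) (1 - zb k)) :=
      mul_le_mul_of_nonneg_right (le_abs_self _)
        (mul_nonneg hus (zMono_nonneg E j (by linarith [(hz k).2]) (by linarith [(hzb k).2])))
    have h2 : |w k| * (z k * zb k) ^ s * zMono E j (1 - z k) (1 - zb k) ≤
        |w k| * (z k * zb k) ^ s * (qr k ^ E * zMono E j (z a) (zb a)) :=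
      mul_le_mul_of_nonneg_left (hRk k) (mul_nonneg (abs_nonneg _) hus)
    calc w k * (z k * zb k) ^ s * zMono E j (1 - z k) (1 - zb k)
        = w k * ((z k * zb k) ^ s * zMono E j (1 - z k) (1 - zb k)) := by ring
      _ ≤ |w k| * ((z k * zb k) ^ s * zMono E j (1 - z k) (1 - zb k)) := h1
      _ = |w k| * (z k * zb k) ^ s * zMono E j (1 - z k) (1 - zb k) := by ring
      _ ≤ |w k| * (z k * zb k) ^ s * (qr k ^ E * zMono E j (z a) (zb a)) := h2
      _ = |w k| * (z k * zb k) ^ s * qr k ^ E * zMono E j (z a) (zb a) := by ring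
  -- assemble
  calc zMono E j (z a) (zb a) *
        (w a * ((1 - z a) * (1 - zb a)) ^ s
          - ∑ k ∈ univ.erase a, |w k| * ((1 - z k) * (1 - zb k)) ^ s * qd k ^ E
          - ∑ k, |w k| * (z k * zb k) ^ s * qr k ^ E)
      = w a * ((1 - z a) * (1 - zb a)) ^ s * zMono E j (z a) (zb a)
          + ∑ k ∈ univ.erase a,
              -(|w k| * ((1 - z k) * (1 - zb k)) ^ s * qd k ^ E * zMono E j (z a) (zb a))
          + ∑ k, -(|w k| * (z k * zb k) ^ s * qr k ^ E * zMono E j (z a) (zb a)) := by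
        rw [sum_neg_distrib, sum_neg_distrib, ← sum_mul, ← sum_mul]
        ring
    _ ≤ w a * ((1 - z a) * (1 - zb a)) ^ s * zMono E j (z a) (zb a)
          + ∑ k ∈ univ.erase a, w k * ((1 - z k) * (1 - zb k)) ^ s * zMono E j (z k) (zb k)
          + ∑ k, -(w k * (z k * zb k) ^ s * zMono E j (1 - z k) (1 - zb k)) :=
        add_le_add (add_le_add le_rfl (sum_le_sum fun k _ => hterm1 k))
          (sum_le_sum fun k _ => hterm2 k)
    _ = ∑ k, w k * ((1 - z k) * (1 - zb k)) ^ s * zMono E j (z k) (zb k)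
          + ∑ k, -(w k * (z k * zb k) ^ s * zMono E j (1 - z k) (1 - zb k)) := by
        rw [add_sum_erase univ (fun k => w k * ((1 - z k) * (1 - zb k)) ^ s * zMono E j (z k) (zb k))
          (mem_univ a)]
    _ = pointFunctional w z zb (crossF s (-1) (zMono E j)) := by
        rw [pointFunctional_apply, ← sum_add_distrib]
        refine sum_congr rfl fun k _ => ?_
        simp only [crossF]
        ring

/-- The unitarity bound dominates the spin: `ℓ ≤ unitarityBound3D ℓ`. [folklore] -/
theorem natCast_le_unitarityBound3D (ℓ : ℕ) : (ℓ : ℝ) ≤ unitarityBound3D ℓ := by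
  unfold unitarityBound3D
  split_ifs with h
  · simp [h]
  · linarith

/-- **Tail rule at a regular point.** In the dominated configuration of
`pointFunctional_crossF_zMono_lower` with all ratios `≤ 1`, the single inequality
`Σ_{k≠a} |w_k| v_k^s qd_k^{Δ⋆} + Σ_k |w_k| u_k^s qr_k^{Δ⋆} ≤ w_a v_a^s`
gives `BlockPositive φ s Δ ℓ` for EVERY spin `ℓ` and every regular `Δ ≥ Δ⋆` above the unitarity
bound: each `z`-series term has `E = Δ + n ≥ Δ⋆` and `j ≤ ℓ + n ≤ E`, so
`φ[F^{s}_{-}[𝒫_{E,j}]] ≥ 𝒫_{E,j}(apex) · B(E) ≥ 𝒫_{E,j}(apex) · B(Δ⋆) ≥ 0`, and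
`blockPositive_pointFunctional_of_forall` applies. [folklore] -/
theorem tail_blockPositive_pointFunctional_of_apex {N : ℕ} (w z zb : Fin N → ℝ)
    (hz : ∀ k, z k ∈ Ioo (0 : ℝ) 1) (hzb : ∀ k, zb k ∈ Ioo (0 : ℝ) 1) (hord : ∀ k, zb k ≤ z k)
    (a : Fin N) (qd qr : Fin N → ℝ) (hqd : ∀ k, 0 < qd k ∧ qd k ≤ 1)
    (hqr : ∀ k, 0 < qr k ∧ qr k ≤ 1)
    (hdomd : ∀ k, z k * zb k ≤ qd k ^ 2 * (z a * zb a) ∧ z k ≤ qd k * z a)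
    (hdomr : ∀ k, (1 - z k) * (1 - zb k) ≤ qr k ^ 2 * (z a * zb a) ∧ 1 - zb k ≤ qr k * z a)
    {Δstar : ℝ} {s : ℝ}
    (hB : ∑ k ∈ univ.erase a, |w k| * ((1 - z k) * (1 - zb k)) ^ s * qd k ^ Δstar
          + ∑ k, |w k| * (z k * zb k) ^ s * qr k ^ Δstar ≤
        w a * ((1 - z a) * (1 - zb a)) ^ s)
    {Δ : ℝ} {ℓ : ℕ} (hΔ : unitarityBound3D ℓ < Δ) (hreg : ¬ accidentalDegeneracy3D Δ ℓ)
    (hΔs : Δstar ≤ Δ) :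
    BlockPositive (pointFunctional w z zb) s Δ ℓ := by
  refine blockPositive_pointFunctional_of_forall w z zb hz hzb hΔ hreg fun q hq => ?_
  have hℓΔ : (ℓ : ℝ) ≤ Δ := (natCast_le_unitarityBound3D ℓ).trans hΔ.le
  have hjE : (q.2 : ℝ) ≤ Δ + (q.1 : ℝ) := by
    have h1 : (q.2 : ℝ) ≤ (ℓ : ℝ) + (q.1 : ℝ) := by exact_mod_cast hq.2.1
    linarith
  have hEs : Δstar ≤ Δ + (q.1 : ℝ) := hΔs.trans (le_add_of_nonneg_right (Nat.cast_nonneg _))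
  have hlow := pointFunctional_crossF_zMono_lower w z zb hz hzb hord a qd qr (fun k => (hqd k).1)
    (fun k => (hqr k).1) hdomd hdomr hjE s
  refine le_trans (mul_nonneg (zMono_nonneg _ _ (hz a).1.le (hzb a).1.le) ?_) hlow
  have hv0 : ∀ k, 0 ≤ (1 - z k) * (1 - zb k) := fun k =>
    mul_nonneg (by linarith [(hz k).2]) (by linarith [(hzb k).2])
  have hu0 : ∀ k, 0 ≤ z k * zb k := fun k => mul_nonneg (hz k).1.le (hzb k).1.le
  have hS1 : ∑ k ∈ univ.erase a, |w k| * ((1 - z k) * (1 - zb k)) ^ s * qd k ^ (Δ + (q.1 : ℝ)) ≤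
      ∑ k ∈ univ.erase a, |w k| * ((1 - z k) * (1 - zb k)) ^ s * qd k ^ Δstar :=
    sum_le_sum fun k _ => mul_le_mul_of_nonneg_left
      (Real.rpow_le_rpow_of_exponent_ge (hqd k).1 (hqd k).2 hEs)
      (mul_nonneg (abs_nonneg _) (Real.rpow_nonneg (hv0 k) s))
  have hS2 : ∑ k, |w k| * (z k * zb k) ^ s * qr k ^ (Δ + (q.1 : ℝ)) ≤
      ∑ k, |w k| * (z k * zb k) ^ s * qr k ^ Δstar :=
    sum_le_sum fun k _ => mul_le_mul_of_nonneg_left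
      (Real.rpow_le_rpow_of_exponent_ge (hqr k).1 (hqr k).2 hEs)
      (mul_nonneg (abs_nonneg _) (Real.rpow_nonneg (hu0 k) s))
  linarith

/-- **Tail obligation (O5) for a point functional with a dominating apex, on a box.** If, in the
dominated configuration, `0 ≤ w_a` and the single number
`B := w_a v_a^{s_hi} - Σ_{k≠a} |w_k| v_k^{s_lo} qd_k^{Δ⋆} - Σ_k |w_k| u_k^{s_lo} qr_k^{Δ⋆}` is `≥ 0`,
then for every `(s, ·) ∈ Q` with `s ∈ [s_lo, s_hi]`, every spin `ℓ` and every `Δ ≥ Δ⋆` above (or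
at) the unitarity bound, `BlockPositive φ s Δ ℓ` — regular points by
`tail_blockPositive_pointFunctional_of_apex` (monotonicity of `v^s`, `u^s` in `s`), the remaining
finitely many points per spin by the limit clause (`blockPositive_of_eventually_right`,
`eventually_isRegularPoint3D_nhdsGT_of_bound_le`). This is obligation (O5) of
`SingleCorrelatorObligations` for such a functional. [folklore] -/
theorem tail_nonneg_pointFunctional_of_apex {N : ℕ} (w z zb : Fin N → ℝ)
    (hz : ∀ k, z k ∈ Ioo (0 : ℝ) 1) (hzb : ∀ k, zb k ∈ Ioo (0 : ℝ) 1) (hord : ∀ k, zb k ≤ z k)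
    (a : Fin N) (ha : 0 ≤ w a) (qd qr : Fin N → ℝ) (hqd : ∀ k, 0 < qd k ∧ qd k ≤ 1)
    (hqr : ∀ k, 0 < qr k ∧ qr k ≤ 1)
    (hdomd : ∀ k, z k * zb k ≤ qd k ^ 2 * (z a * zb a) ∧ z k ≤ qd k * z a)
    (hdomr : ∀ k, (1 - z k) * (1 - zb k) ≤ qr k ^ 2 * (z a * zb a) ∧ 1 - zb k ≤ qr k * z a)
    {Q : Set (ℝ × ℝ)} {slo shi Δstar : ℝ} (hQ : ∀ p ∈ Q, slo ≤ p.1 ∧ p.1 ≤ shi)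
    (hB : ∑ k ∈ univ.erase a, |w k| * ((1 - z k) * (1 - zb k)) ^ slo * qd k ^ Δstar
          + ∑ k, |w k| * (z k * zb k) ^ slo * qr k ^ Δstar ≤
        w a * ((1 - z a) * (1 - zb a)) ^ shi) :
    ∀ p ∈ Q, ∀ ℓ : ℕ, ∀ Δ : ℝ, unitarityBound3D ℓ ≤ Δ → Δstar ≤ Δ →
      BlockPositive (pointFunctional w z zb) p.1 Δ ℓ := by
  intro p hp ℓ Δ hbd hΔs
  have hv : ∀ k, 0 < (1 - z k) * (1 - zb k) ∧ (1 - z k) * (1 - zb k) ≤ 1 := fun k =>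
    ⟨mul_pos (by linarith [(hz k).2]) (by linarith [(hzb k).2]),
      mul_le_one₀ (by linarith [(hz k).1]) (by linarith [(hzb k).2]) (by linarith [(hzb k).1])⟩
  have hu : ∀ k, 0 < z k * zb k ∧ z k * zb k ≤ 1 := fun k =>
    ⟨mul_pos (hz k).1 (hzb k).1, mul_le_one₀ (hz k).2.le (hzb k).1.le (hzb k).2.le⟩
  -- the inequality at s = p.1 from the one on the box
  have hBs : ∑ k ∈ univ.erase a, |w k| * ((1 - z k) * (1 - zb k)) ^ p.1 * qd k ^ Δstar
        + ∑ k, |w k| * (z k * zb k) ^ p.1 * qr k ^ Δstar ≤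
      w a * ((1 - z a) * (1 - zb a)) ^ p.1 := by
    have h1 : ∑ k ∈ univ.erase a, |w k| * ((1 - z k) * (1 - zb k)) ^ p.1 * qd k ^ Δstar ≤
        ∑ k ∈ univ.erase a, |w k| * ((1 - z k) * (1 - zb k)) ^ slo * qd k ^ Δstar :=
      sum_le_sum fun k _ => mul_le_mul_of_nonneg_right
        (mul_le_mul_of_nonneg_left
          (Real.rpow_le_rpow_of_exponent_ge (hv k).1 (hv k).2 (hQ p hp).1) (abs_nonneg _))
        (Real.rpow_nonneg (hqd k).1.le _)
    have h2 : ∑ k, |w k| * (z k * zb k) ^ p.1 * qr k ^ Δstar ≤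
        ∑ k, |w k| * (z k * zb k) ^ slo * qr k ^ Δstar :=
      sum_le_sum fun k _ => mul_le_mul_of_nonneg_right
        (mul_le_mul_of_nonneg_left
          (Real.rpow_le_rpow_of_exponent_ge (hu k).1 (hu k).2 (hQ p hp).1) (abs_nonneg _))
        (Real.rpow_nonneg (hqr k).1.le _)
    have h3 : w a * ((1 - z a) * (1 - zb a)) ^ shi ≤ w a * ((1 - z a) * (1 - zb a)) ^ p.1 :=
      mul_le_mul_of_nonneg_left
        (Real.rpow_le_rpow_of_exponent_ge (hv a).1 (hv a).2 (hQ p hp).2) ha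
    linarith
  by_cases hregpt : IsRegularPoint3D Δ ℓ
  · exact tail_blockPositive_pointFunctional_of_apex w z zb hz hzb hord a qd qr hqd hqr hdomd hdomr
      hBs (lt_of_le_of_ne hbd (Ne.symm hregpt.1)) hregpt.2 hΔs
  · refine blockPositive_of_eventually_right w z zb hz hzb p.1 Δ ℓ hregpt ?_
    filter_upwards [eventually_isRegularPoint3D_nhdsGT_of_bound_le hbd, self_mem_nhdsWithin]
      with Δ' hΔ' hgt
    have hgt' : Δ < Δ' := Set.mem_Ioi.1 hgt
    exact ⟨hΔ', tail_blockPositive_pointFunctional_of_apex w z zb hz hzb hord a qd qr hqd hqr hdomd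
      hdomr hBs (lt_of_le_of_lt hbd hgt') hΔ'.2 (hΔs.trans hgt'.le)⟩

end Literature.MathematicalPhysics.QuantumFieldTheory.ConformalBootstrap3D
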